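import Summits.ResolutionOfSingularities.ResolutionOfSingularities.Theorems.WeightedInvariantWeightedThesisHypersurfaceStrategy
import Summits.ResolutionOfSingularities.ResolutionOfSingularities.Theorems.WeightedInvariantWeightedThesisHypersurfaceTowerRegular
import Mathlib.Order.WellFoundedSet
import HarnessLib

/-!
# Hypersurface RATED rules — an invariant without a global well-order (door (γ) as a typed object)

Route `ResolutionOfSingularities/WeightedInvariant`, crux `Theses.WeightedInvariant.WeightedThesis`
(stmt-ResolutionOfSingularities-0569), line `datum-glued-split`, lead c8, RESHAPE 8 — second object file.

Between the hypersurface DATUM of RESHAPE 7 (`HypersurfaceResolutionDatum p`: ONE well-ordered `Γ`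
for all dimensions, an upper semicontinuous invariant, …) and the hypersurface STRATEGY of RESHAPE 8
(`HypersurfaceCentreStrategy p`: no invariant at all, termination of the tower demanded directly)
sits the shape a constructor actually produces (Abramovich–Temkin–Włodarczyk 2024; Abramovich–Quek–
Schober; the 0571 line `pointwise-lexmax-hull`): an INVARIANT `inv` into a linearly ordered value set,
a centre on its maximum locus, a drop of `inv` on the cobordant charts — where the value set need NOT
be well-ordered as a whole (the `∞`-lex order on profiles of all lengths is not:
`(2,3) > (2,2,5) > (2,2,4,7) > ⋯`, census `Cruxes/WeightedConstruction/STRATEGY-CENSUS.md` §6 (γ),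
cdisprove Part I §2), only on the values met ALONG THE TOWERS OF ONE PAIR.

* `HypersurfaceRatedRule p` — `Γ` a LINEAR order (no `WellFoundedLT`); `inv`, `centre`; on singular
  integral hypersurface pairs over perfect fields of characteristic `p`: `inv` takes finitely many
  values (no upper semicontinuity), `(i)` `inv` is functorial for smooth `k`-morphisms, `(ii')` the
  generic point of the hypersurface is off the centre, `(iii)` the centre is a regular weighted centre,
  `(i)` for the centre under smooth surjections, `(iv)` on every cobordant chart `B₊(U)` the invariant of
  the strict transform is everywhere strictly below `max_Y inv`, and `(wf)` for every START pair `P₀` the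
  set of values of `inv` on the pairs reachable from `P₀` by tower steps is well-ordered (`Set.IsWF`);
* `HypersurfaceRatedRule.ofDatum` — every hypersurface resolution datum is a rated rule (finitely many
  values by `(usc)` on a Noetherian space; `(wf)` from the global well-order; the guards from `(ii)`);
* `hyp_exists_isMax_of_finite_range` (registered stub of the line) — a function with finitely many
  values on a non-empty type attains its maximum (the replacement of `exists_isMax_inv`, which used
  `(usc)`).

That a rated rule is a STRATEGY (`(iv)` + `(i)` give the drop of `max inv` along every global tower
step, `(wf)` makes the reachable part of the tower-step relation well-founded) is proved in
`Theorems/WeightedInvariantWeightedThesisHypersurfaceRatedRuleStrategy.lean`; so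
`WeightedResolutionDatum p → HypersurfaceResolutionDatum p → HypersurfaceRatedRule p →
Nonempty (HypersurfaceCentreStrategy p)`, three typed restatement targets for stmt-0571 of decreasing
strength, each with the consumer side landed.
-/

noncomputable section

open CategoryTheory AlgebraicGeometry TopologicalSpace
open Literature.AlgebraicGeometry.Resolution

set_option linter.dupNamespace false -- mandated namespace of this single-conjunct summit

namespace Summit.ResolutionOfSingularities.ResolutionOfSingularities.Theorems

/-- **Hypersurface rated rule in characteristic `p`** (object posited by line `datum-glued-split` of
crux `WeightedThesis`, RESHAPE 8 — door (γ)): a LINEARLY ordered value type `Γ` (not assumed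
well-ordered), a total rating `inv f X : Y → Γ` and a total centre `centre f X : ReesAlgebraData Y`,
such that for `k` perfect of characteristic `p`, `f : Y → Spec k` smooth separated quasi-compact and
`X` a locally principal ideal sheaf with integral closed subscheme: `(fin)` `inv f X` takes finitely
many values; `(i)` `inv` is functorial for smooth `k`-morphisms; and when `V(X)` is NOT regular:
`(ii')` the generic point of the hypersurface is off the centre, `(iii)` the centre is a regular weighted
centre, `(i)` the centre is functorial for smooth surjective `k`-morphisms, `(iv)` on the cobordant
blow-up `B₊(U)` of every affine chart, with the strict transform, `inv` is everywhere strictly below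
`max_Y inv`; and `(wf)` for every hypersurface pair `P₀` over a perfect field of characteristic `p` the
set of values of `inv` on the pairs reachable from `P₀` along the tower-step relation
`HypersurfacePair.Step centre` is well-ordered. Shape of Abramovich–Temkin–Włodarczyk 2024 Thm. 1.1.1 /
Włodarczyk arXiv:2203.03090 Thm. 4.3.1 restricted to hypersurfaces, with the well-order asked only
tower by tower. EVIDENCE, not a claim. -/
structure HypersurfaceRatedRule (p : ℕ) : Type 1 where
  /-- the value set of the invariant -/
  Γ : Type
  /-- `Γ` is linearly ordered (NOT assumed well-ordered) -/
  [linearOrder : LinearOrder Γ]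
  /-- the invariant `inv_{(Y,X)} : |Y| → Γ` (total) -/
  inv : ∀ ⦃k : Type⦄ [Field k] ⦃Y : Scheme.{0}⦄, (Y ⟶ Spec (.of k)) → Y.IdealSheafData → Y → Γ
  /-- the weighted centre of `(Y, X)`, as a Rees algebra on `Y` (total) -/
  centre : ∀ ⦃k : Type⦄ [Field k] ⦃Y : Scheme.{0}⦄, (Y ⟶ Spec (.of k)) → Y.IdealSheafData →
    ReesAlgebraData Y
  /-- `(fin)` [hypersurface pairs] the invariant takes finitely many values -/
  finite_range_inv : ∀ ⦃k : Type⦄ [Field k] [CharP k p] [PerfectField k] ⦃Y : Scheme.{0}⦄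
    (f : Y ⟶ Spec (.of k)) [Smooth f] [IsSeparated f] [QuasiCompact f] (X : Y.IdealSheafData),
    IsLocallyPrincipal X → IsIntegral X.subscheme → (Set.range (inv f X)).Finite
  /-- `(i)` [hypersurface pairs] functoriality of `inv` for smooth `k`-morphisms `g : Y₁ → Y` -/
  inv_comap : ∀ ⦃k : Type⦄ [Field k] [CharP k p] [PerfectField k] ⦃Y Y₁ : Scheme.{0}⦄
    (f : Y ⟶ Spec (.of k)) [Smooth f] [IsSeparated f] [QuasiCompact f]
    (f₁ : Y₁ ⟶ Spec (.of k)) [Smooth f₁] [IsSeparated f₁] [QuasiCompact f₁]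
    (g : Y₁ ⟶ Y) [Smooth g], g ≫ f = f₁ →
    ∀ (X : Y.IdealSheafData), IsLocallyPrincipal X → IsIntegral X.subscheme →
    ∀ (y₁ : Y₁), inv f₁ (X.comap g) y₁ = inv f X (g y₁)
  /-- `(ii')` [singular hypersurface pairs, presented by a closed immersion `i`] the generic point of
  the hypersurface is off the centre -/
  genericPoint_not_mem_support_centre : ∀ ⦃k : Type⦄ [Field k] [CharP k p] [PerfectField k]
    ⦃Y X : Scheme.{0}⦄ (f : Y ⟶ Spec (.of k)) [Smooth f] [IsSeparated f] [QuasiCompact f]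
    (i : X ⟶ Y) [IsClosedImmersion i] [IsIntegral X], IsLocallyPrincipal i.ker →
    ¬ Scheme.IsRegular X → i (genericPoint X) ∉ (centre f i.ker).support
  /-- `(iii)` [singular hypersurface pairs] the centre is a regular weighted centre -/
  isRegularWeightedCentre_centre : ∀ ⦃k : Type⦄ [Field k] [CharP k p] [PerfectField k]
    ⦃Y : Scheme.{0}⦄ (f : Y ⟶ Spec (.of k)) [Smooth f] [IsSeparated f] [QuasiCompact f]
    (X : Y.IdealSheafData), IsLocallyPrincipal X → IsIntegral X.subscheme →
    ¬ Scheme.IsRegular X.subscheme → (centre f X).IsRegularWeightedCentre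
  /-- `(i)` for the centre [singular hypersurface pairs]: smooth SURJECTIVE `k`-morphisms -/
  centre_comap : ∀ ⦃k : Type⦄ [Field k] [CharP k p] [PerfectField k] ⦃Y Y₁ : Scheme.{0}⦄
    (f : Y ⟶ Spec (.of k)) [Smooth f] [IsSeparated f] [QuasiCompact f]
    (f₁ : Y₁ ⟶ Spec (.of k)) [Smooth f₁] [IsSeparated f₁] [QuasiCompact f₁]
    (g : Y₁ ⟶ Y) [Smooth g] [Surjective g], g ≫ f = f₁ →
    ∀ (X : Y.IdealSheafData), IsLocallyPrincipal X → IsIntegral X.subscheme →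
    ¬ Scheme.IsRegular X.subscheme →
    ∀ n : ℕ, (centre f₁ (X.comap g)).piece n = ((centre f X).piece n).comap g
  /-- `(iv)` [singular hypersurface pairs] the invariant DROPS on the cobordant blow-up of every
  affine chart, with the strict transform, strictly below `max_Y inv` -/
  inv_cobordantPlus_lt : ∀ ⦃k : Type⦄ [Field k] [CharP k p] [PerfectField k]
    ⦃Y : Scheme.{0}⦄ (f : Y ⟶ Spec (.of k)) [Smooth f] [IsSeparated f] [QuasiCompact f]
    (X : Y.IdealSheafData), IsLocallyPrincipal X → IsIntegral X.subscheme →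
    ¬ Scheme.IsRegular X.subscheme →
    ∀ (U : Y.affineOpens) (b : (centre f X).cobordantPlus U) (y : Y),
      (∀ y' : Y, inv f X y' ≤ inv f X y) →
      inv ((centre f X).cobordantPlusι U ≫ f) ((centre f X).cobordantStrictTransform U X) b
        < inv f X y
  /-- `(wf)` over every perfect field of characteristic `p`: the values of `inv` met along the towers
  of ONE pair are well-ordered -/
  isWF_values : ∀ ⦃k : Type⦄ [Field k] [CharP k p] [PerfectField k] (P₀ : HypersurfacePair k),
    {γ : Γ | ∃ P : HypersurfacePair k,
      Relation.ReflTransGen (fun P P' : HypersurfacePair k =>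
        HypersurfacePair.Step (fun ⦃Y : Scheme.{0}⦄ (f : Y ⟶ Spec (.of k)) X => centre f X) P' P)
        P₀ P ∧ γ ∈ Set.range (inv P.f P.X)}.IsWF

namespace HypersurfaceRatedRule

variable {p : ℕ}

/-- The value set is linearly ordered (structure field as an instance). [folklore] -/
instance instLinearOrder (R : HypersurfaceRatedRule p) : LinearOrder R.Γ := R.linearOrder

/-- **Every hypersurface resolution datum is a hypersurface rated rule** (keep `Γ`, `inv`, `centre`):
finitely many values by `(usc)` on the Noetherian `Y` (`HypersurfaceTower.finite_range_inv`), `(wf)`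
from the global well-order on `Γ`, the guards of `(iii)`, `(i)` for the centre and `(iv)` from
non-regularity by `(ii)` (`hyp_exists_not_isBot_inv_of_not_isRegular`), the generic point off the
centre by `(ii)` + `(iii)` (`HypersurfaceTower.genericPoint_not_mem_support_centre`). [folklore] -/
def ofDatum (D : HypersurfaceResolutionDatum p) : HypersurfaceRatedRule p where
  Γ := D.Γ
  inv := D.inv
  centre := D.centre
  finite_range_inv := fun _ _ _ _ _ f _ _ _ X hX hXi =>
    HypersurfaceTower.finite_range_inv D f X hX hXi
  inv_comap := fun _ _ _ _ _ _ f _ _ _ f₁ _ _ _ g _ hg X hX hXi y₁ =>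
    D.inv_comap f f₁ g hg X hX hXi y₁
  genericPoint_not_mem_support_centre := fun _ _ _ _ _ _ f _ _ _ i _ _ hX hsing =>
    HypersurfaceTower.genericPoint_not_mem_support_centre D f i hX
      (HypersurfaceTower.isIntegral_ker_subscheme i)
      (hyp_exists_not_isBot_inv_of_not_isRegular D f i.ker hX
        (HypersurfaceTower.isIntegral_ker_subscheme i)
        fun h => hsing ((isRegular_iff_isRegular_image i).mpr h))
  isRegularWeightedCentre_centre := fun _ _ _ _ _ f _ _ _ X hX hXi hsing =>
    D.isRegularWeightedCentre_centre f X hX hXi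
      (hyp_exists_not_isBot_inv_of_not_isRegular D f X hX hXi hsing)
  centre_comap := fun _ _ _ _ _ _ f _ _ _ f₁ _ _ _ g _ _ hg X hX hXi hsing n =>
    D.centre_comap f f₁ g hg X hX hXi
      (hyp_exists_not_isBot_inv_of_not_isRegular D f X hX hXi hsing) n
  inv_cobordantPlus_lt := fun _ _ _ _ _ f _ _ _ X hX hXi hsing U b y hy =>
    D.inv_cobordantPlus_lt f X hX hXi
      (hyp_exists_not_isBot_inv_of_not_isRegular D f X hX hXi hsing) U b y hy
  isWF_values := fun _ _ _ _ _ => Set.IsWF.of_wellFoundedLT _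

/-- `ofDatum` keeps the value set. [folklore] -/
@[simp] theorem ofDatum_Γ (D : HypersurfaceResolutionDatum p) : (ofDatum D).Γ = D.Γ := rfl

/-- `ofDatum` keeps the invariant. [folklore] -/
@[simp] theorem ofDatum_inv (D : HypersurfaceResolutionDatum p) : (ofDatum D).inv = D.inv := rfl

/-- `ofDatum` keeps the centre. [folklore] -/
@[simp] theorem ofDatum_centre (D : HypersurfaceResolutionDatum p) :
    (ofDatum D).centre = D.centre := rfl

/-- **The hypersurface construction implies the rated rule**: a hypersurface resolution datum in
characteristic `p` gives a hypersurface rated rule in characteristic `p`. [folklore] -/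
theorem nonempty_of_nonempty_hypersurfaceDatum (h : Nonempty (HypersurfaceResolutionDatum p)) :
    Nonempty (HypersurfaceRatedRule p) :=
  h.map ofDatum

end HypersurfaceRatedRule

/-! ## The maximum of a function with finitely many values -/

/-- **A function with finitely many values on a non-empty type attains its maximum** (registered
stub of line `datum-glued-split`, RESHAPE 8: the replacement, for rated rules, of
`HypersurfaceTower.exists_isMax_inv`, which used upper semicontinuity). [folklore] -/
theorem hyp_exists_isMax_of_finite_range : ∀ {Y Γ : Type} [LinearOrder Γ] [Nonempty Y] (v : Y → Γ), (Set.range v).Finite → ∃ y : Y, ∀ y' : Y, v y' ≤ v y := by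
  intro Y Γ _ _ v hv
  obtain ⟨γ, hγ, hmax⟩ := hv.toFinset.exists_max_image id
    ⟨v (Classical.arbitrary Y), by simp⟩
  obtain ⟨y, rfl⟩ : γ ∈ Set.range v := by simpa using hγ
  exact ⟨y, fun y' => hmax (v y') (by simp)⟩

end Summit.ResolutionOfSingularities.ResolutionOfSingularities.Theorems

end
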